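import Summits.CriticalPhenomena.SAWScalingLimit.Theses.SAWLeftRightFKG
import Summits.CriticalPhenomena.SAWScalingLimit.Theses.SAWTotalPositivity
import Summits.CriticalPhenomena.SAWScalingLimit.Theorems.TPToTraversalBound.Negative.TPToTraversalBoundLogic
import Summits.CriticalPhenomena.SAWScalingLimit.Theorems.TPToTraversalBound.Negative.TPToTraversalBoundDeepStart
import Literature.Probability.RandomPlanarGeometry.SAWSideProbability
import Literature.Probability.Percolation.CLE6Proofs
import Literature.Probability.RandomPlanarGeometry.SelfAvoidingWalkProofs
import Literature.Probability.LatticeModels.CellDomainBoundary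

/-!
# Disproof work file — crux `FKGToTraversalBound` (stmt-CriticalPhenomena-1878), standing disprover

Route `SAWLeftRightFKG`, sub-problem `SAWScalingLimit`.  The crux is the glue
`FKGToTraversalBound := LeftRightFKG → SAWTraversalBound` (`Iff.rfl`, `iff_imp`): left–right positive
association (PA) of the critical square-lattice SAW chord measure in every simply connected lattice
domain between BOUNDARY-ADJACENT endpoints should give the Aizenman–Burchard hypothesis (H1) for the
chordal critical SAW, for EVERY Dobrushin domain and EVERY endpoint approximation `IsEndpointApprox`.

## Findings (index; numbers, not adjectives)

* **F1 (logic, §1–§2, certified).** `¬ crux ↔ PA ∧ ¬(H1)` (`not_crux_iff`): a disproof of this crux is a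
  PROOF of the rank-2 crux `LeftRightFKG` together with a DISPROOF of (H1) = `SAWTraversalBound`
  (stmt-1880, believed true: SLE_{8/3} picture).  The only dropped-hypothesis variant is (H1) itself
  (`WithoutPA`), so no `_false_without_` certificate exists unless (H1) fails.  Conversely `¬ LeftRightFKG`
  closes the crux VACUOUSLY (`of_not_leftRightFKG`) — the standing disprover of r2 (rattack/cdisprove
  stmt-11232: 0 violations at x ≤ 0.3846 in every finite search; corner thresholds
  x₀(L) = x_c + 0.91·L^{-4/3}, Cov(x_c) ≍ +C·L^{-3.35}) is therefore also the cheapest prover of r3.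
  The crux is MONOTONE in its hypothesis (`mono_hyp`): any consequence `P` of PA with `P → (H1)` proves it,
  so a prover may (and, by F3, must) replace PA by the sub-family the scheme really consumes.
* **F2 (junk audit of the conclusion).** Identical decl text to `SAWTotalPositivity.SAWTraversalBound`
  (`traversalBound_iff_TP`, `Iff.rfl`), so the sibling disprover's certified audit is IMPORTED, not redone:
  mass ≤ 1 (`law_apply_le_one`), all-δ ↔ eventual (`allMesh_iff`), threshold may dominate any prescribed
  forcing count (`traversalBound_iff_threshold_ge`), deep endpoints are in scope
  (`exists_isEndpointApprox_deepStart`: ball(a_δ, √δ) ⊆ D for δ ≤ 1/16).  Nothing exploitable; (H1) is a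
  faithful AB99 (1.3) with shell-dependent threshold.
* **F3 (NEW — the hypothesis cannot be instantiated where the conclusion still bites; §3–§4,
  certified + computed).**  The scheme's step (i) ("the future after the j-th traversal is an x_c-SAW
  in the slit domain from a boundary-adjacent tip, exactly r2's setting") is FALSE IN SCOPE:
  (a) `LeftRightFKG` requires BOTH endpoints lattice-adjacent to the boundary walk `C`; the conclusion
  ranges over endpoint approximations whose start AND end sit at depth √δ/δ → ∞ lattice units
  (`exists_isEndpointApprox_deepStart`, mirrored).  For such approximations NO conditional chord
  ensemble (time 0; after "conditioning on the first step" = punctured domain; after any finite past =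
  floating slit) has a boundary-adjacent TARGET, and — weight-free, at EVERY fugacity — its left–right
  poset has several maximal chords, which kills the PA inequality outright
  (`not_PAClause_of_two_maximal`: A = {m₁}, B = {m₂} are up-closed, w(A)w(B) > 0 = w(univ)·w(∅)).
  Exact enumeration (this folder job1/lrposet.py + paircov.py, pure-python exact integer polynomials;
  order = height-vector dominance, the exact reading of the typed `le`, agreeing with rattack-11232):
  BOTH-DEEP carriers — 5×5 box a=(2,2), b=(3,3): 3762 chords, 7 maximal / 7 minimal; a=(1,1), b=(3,3):
  6/6; punctured 5×5∖{(1,1)} (first-step conditioning of a deep start), tip a=(2,1) → deep b=(3,3): 1065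
  chords, 4/3; DOUBLE puncture (first- AND last-step conditioning, both tips adjacent to their floating
  1-vertex pasts) 5×5∖{(1,1),(3,3)}, (2,1)→(3,2): 2/2 and (1,2)→(2,3): 2/2; 5×5∖{(1,2),(3,2)},
  (2,2)→(3,3): 2/1; 6×5∖{(1,2),(4,2)}, (2,2)→(3,2): 3/3; 6×6∖{(2,2),(3,3)}, (2,1)→(4,3): 24888 chords,
  8/4 — so NO conditioning device yields a positively associated carrier when both marked points are deep;
  the pairwise face-event scan shows the failure directly (2–17 pairs of DISJOINT up-events of positive
  mass, normalised covariance −1, at x = 10/27, x̂_c, 10/26).  CONTROLS (r2-admissible: boxes ≤ 5×4 all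
  shown, boundary slits with tip start; and holes WITH boundary-adjacent endpoints, 5×5∖{(1,1),(3,3)},
  (1,0)→(4,3)): unique top/bottom and 0 negative pairs, min normalised pair covariance at x̂_c between
  1.3·10⁻⁵ and 5.2·10⁻² (holes: 5.6·10⁻³).  ONE-DEEP carriers (interior target only; punctured or
  floating-slit start with boundary target; 9 instances to 5×5): unique top/bottom and 0 negative pairs of
  435–703, but margins down to 2.6·10⁻¹⁰ (5×5, (0,0)→(2,2), x = 10/27) — pairwise PA survives there, so the
  target-free extension `LeftRightFKGFreeTarget` (§4) is CONSISTENT with all data and is exactly what a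
  one-deep endpoint approximation would need; it is not supplied by r2.  Larger instances (6×6, 7×6;
  numpy covariance matrices) run as kit job j008707 (queued at publication; results auto-attach to the item).
  (b) Even with a boundary target, the conditional domains of a deep START are not in r2's class:
  `{z | wind(C,z) ≠ 0}` has simply connected components (the trace of `C` is connected), so its lattice
  vertex set has no floating holes, whereas Ω_δ ∖ {a_δ} (the planner's "condition on the first step")
  has one — CERTIFIED: `noFloatingHoles` and `not_presentable_of_enclosed` (§6).
  (c) For a general Jordan `D`, `discreteDomainGraph D.carrier δ` need not be an INDUCED subgraph of ℤ²
  (mesh edges are dropped when `[δx,δy] ⊄ closure D`), while every r2 domain is induced (a primal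
  boundary walk cannot separate two adjacent off-trace sites) — a second class mismatch, harmless for
  smooth `D` and small δ, live for oscillating prime ends.
  UPSHOT for planners/provers: the typed r3 contains an (H1)-fragment — shells around deep marked
  points, ratio ρ/R down to √δ — on which its hypothesis is silent and its natural extension is false;
  that fragment needs interior/whole-plane return estimates for the critical SAW (3 legs: x₃ − x₁ = 3/2
  < 2, so k ≥ 4 there; sibling F2 v), for which this route names no tool.  STATEMENT-LEVEL by-product
  (for the auditor, not this seat's to fix): Duminil-Copin–Smirnov 2012 p. 7 (arXiv:1007.0575, read this
  session, the sentence before Conjecture 1) take "a_δ and b_δ to be the vertices of Ω_δ CLOSEST to a and b";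
  `SAW.IsEndpointApprox` admits any depth with mesh points → a, b, so the typed conjunct `SAWScalingLimit` is
  STRONGER than the printed Conjecture 1 exactly on the deep-endpoint fragment.  Minimal honest repairs:
  (R1) restrict `IsEndpointApprox` in `SAWTraversalBound`/`FKGToTraversalBound` to lattice-boundary
  endpoints (a_δ, b_δ ∈ meshBoundary) AND add a separate item "deep-endpoint reduction" (convergence for
  boundary approximations ⇒ for all approximations — itself needing tightness near deep starts); or
  (R2) strengthen the hypothesis to a PA statement for tip-to-ARBITRARY-target chords in slit domains
  with floating slits — whose weight-free consistency (unique top) is confirmed above but whose truth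
  at x_c is untested beyond j008707.
* **F4 (why the mechanism also resists a cheap kill at boundary endpoints).** The informal engine
  "PA + D₄ + Kesten u_T ≤ 1 ⇒ unforced annulus crossing ≤ 1 − ε uniformly in the past" (KS17 Condition
  G2 for SAW) is NOT refuted by corridor energetics: by KS17 Def. 2.2 (arXiv:1212.6215v3 p.9, read) an
  unforced component of A ∩ U_τ touches at most one boundary arc of the slit domain, so the region
  behind its inner arc is a dead-end pocket; every configuration I built in which the SAW's only wide
  route dives to radius ρ turned out to make the component touch both arcs (forced) or the annulus thin
  (R/ρ ≈ 1).  G2 for SAW stays open (KS17 §4 verifies it for FK/percolation/HE/LERW only; for LERW via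
  quads whose far side is a dead end, Prop. 4.11/Thm 4.12, p.27–28) — consistent, unproved, and not
  attackable by a finite computation I can see.
* **Literature.** KS17 (arXiv:1212.6215v3) pp. 4, 9–11, 25–28 read this session (Def. 1.1/2.2, Cond.
  G2/C2, Remark 2.10, §4.2 percolation, §4.4 LERW, §4.5 UST fails G2).  No print on PA or RSW for SAW
  (groundings g27-3/13/18 concur: KST2023 Thm 1, DGPS17 Prop 8 are configuration-measure statements).

* **CYCLE 2 (gen 2, 2026-08-16) — F5–F9, §8–§10.**  F5 (STRUCTURE, paper theorem §8): on every
  ADMISSIBLE carrier `≼` is exactly facewise crossing dominance and the chord poset has a TOP and a BOTTOM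
  (loop-erased outer facial walk; argmax-region/Stokes argument) ⇒ the weight-free two-maximal kill of §3 never
  fires in r2's class (`maximal_unique_of_top`), kissing corners break only `∨/∧`; F3's multiple maxima are
  precisely the failure of `a, b ∈ ∂F∞`.  §9 (certified): the repair R1 typed — `SAWTraversalBoundBdry`,
  `FKGToTraversalBoundBdry`, `DeepEndpointReduction`, `crux_iff_split` (crux ⟺ R1-crux ∧ (PA → reduction)), and
  `exists_isEndpointApprox_not_bdryApprox`: the R1 class provably omits an admissible approximation of the disc
  (`not_mem_meshBoundary_of_ball_subset` + sibling deep start), so every surviving engine proves at best the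
  R1-crux.  LANDED as `Theorems/FKGToTraversalBound/Negative/R1Split.lean` (p82017, commit f1ac4d4b37c0; planners
  may import `Negative.SAWTraversalBoundBdry` / `Negative.DeepEndpointReduction` verbatim as the two repair items).
  `Negative/FreeFalse.lean` (unconditional `¬ LeftRightFKGFree` transported from the r2-disprover's certified
  double spiral, + `free_chain`) is written in the session folder and files as soon as the farm has built
  `LeftRightFKG.Negative.WithoutBoundaryAdjacency`.  §10 (computed, exact rationals): F6 one-deep-target PA HOLDS on all 206 box carriers ≤ 6×6 (N ≤ 1.03·10⁶ chords)
  with margins `10⁻⁸ → 4·10⁻¹⁵`, top/bottom unique (also on 9 000+ random one-defect carriers); F7 floating-past + boundary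
  target: PA holds (`10⁻⁷…10⁻¹³`), the obstruction there is RSW not association; F8 two winding defects (both
  deep — PROVED by the r2 disprover, supersedes `TwoMaxFree`; or floating past + deep target — NEW, 3 instances):
  PA false weight-free; F9 the defect-count pattern and what repair (R2) would and would not buy.

## Sections
§1 logic · §2 load-bearing · §3 the PA clause abstractly; two maximal chords kill it (certified) ·
§4 the mutated hypotheses `LeftRightFKGFree` / `LeftRightFKGFreeTarget` and their status ·
§5 imported junk audit of (H1) (sibling, certified) · §6 no floating holes (certified) ·
§8 F5 structure: top/bottom on admissible carriers (paper proof + certified corollaries) ·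
§9 R1 typed + certified deep-fragment member · §10 computed PA status off the R1 class (F6–F8) ·
Targets (none assigned; triage stub kills listed) · §7 near-misses (none).
-/

namespace Summit.CriticalPhenomena.SAWScalingLimit.Cruxes.FKGToTraversalBound.Disproof

open Summit.CriticalPhenomena.SAWScalingLimit.Theses.SAWLeftRightFKG
open Literature.Probability.RandomPlanarGeometry Literature.Probability.LatticeModels MeasureTheory
open Literature.Topology.PlaneTopology Set

/-! ## §1 Logic of the crux: it is the glue `PA → (H1)` -/

/-- The crux is literally the implication `LeftRightFKG → SAWTraversalBound`. [folklore] -/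
theorem iff_imp : FKGToTraversalBound ↔ (LeftRightFKG → SAWTraversalBound) := Iff.rfl

/-- A disproof of the crux is EXACTLY a proof of left–right PA together with a disproof of (H1). [folklore] -/
theorem not_crux_iff : ¬ FKGToTraversalBound ↔ LeftRightFKG ∧ ¬ SAWTraversalBound :=
  Classical.not_imp

/-- Any proof of (H1) closes the crux. [folklore] -/
theorem of_traversalBound (h : SAWTraversalBound) : FKGToTraversalBound := fun _ => h

/-- Ex falso: a refutation of the rank-2 crux closes this crux vacuously. [folklore] -/
theorem of_not_leftRightFKG (h : ¬ LeftRightFKG) : FKGToTraversalBound := fun h' => absurd h' h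

/-- The crux as a disjunction. [folklore] -/
theorem crux_iff_or : FKGToTraversalBound ↔ (¬ LeftRightFKG ∨ SAWTraversalBound) := imp_iff_not_or

/-- A refuter of this crux must first PROVE `LeftRightFKG`. [folklore] -/
theorem leftRightFKG_of_not_crux (h : ¬ FKGToTraversalBound) : LeftRightFKG := (not_crux_iff.1 h).1

/-- … and must REFUTE (H1). [folklore] -/
theorem not_traversalBound_of_not_crux (h : ¬ FKGToTraversalBound) : ¬ SAWTraversalBound :=
  (not_crux_iff.1 h).2

/-- MONOTONICITY IN THE HYPOTHESIS: the prover may replace PA by any of its consequences `P` that still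
yields (H1) (e.g. same-side hull-avoidance monotonicity, the sub-family the RSW scheme consumes). [folklore] -/
theorem mono_hyp {P : Prop} (hP : LeftRightFKG → P) (h : P → SAWTraversalBound) : FKGToTraversalBound :=
  fun hl => h (hP hl)

/-- Downstream use inside the route: with r2 the crux delivers (H1), and with the glue item eventual
tightness. [folklore] -/
theorem eventualTight_of (h₁ : LeftRightFKG) (h₂ : FKGToTraversalBound) (h₃ : TraversalBoundTight) :
    EventualTight :=
  h₃ (h₂ h₁)

/-! ## §2 Load-bearing analysis: the only hypothesis is PA -/

/-- The crux with its hypothesis dropped: (H1) itself. [folklore] -/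
def WithoutPA : Prop := SAWTraversalBound

/-- The dropped-hypothesis variant implies the crux. [folklore] -/
theorem of_withoutPA (h : WithoutPA) : FKGToTraversalBound := fun _ => h

/-- `¬ WithoutPA` is a disproof of (H1): a `_false_without_PA` certificate cannot exist unless (H1) —
believed true — fails. [folklore] -/
theorem not_withoutPA_iff : ¬ WithoutPA ↔ ¬ SAWTraversalBound := Iff.rfl

/-! ## §3 The PA clause abstractly; two maximal chords kill it at every fugacity -/

/-- The positive-association clause of `LeftRightFKG` for ONE carrier: for all `le`-up-closed `A, B`,
`w(A) w(B) ≤ w(univ) w(A ∩ B)`. [folklore] -/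
def PAClause {ι : Type*} [MeasurableSpace ι] (le : ι → ι → Prop) (w : Measure ι) : Prop :=
  ∀ A B : Set ι, (∀ γ₁ γ₂, le γ₁ γ₂ → γ₁ ∈ A → γ₂ ∈ A) → (∀ γ₁ γ₂, le γ₁ γ₂ → γ₁ ∈ B → γ₂ ∈ B) →
    w A * w B ≤ w Set.univ * w (A ∩ B)

/-- The crux's domain `Ω(C, δ) = {z | wind(δ-polyline of C, z) ≠ 0}` — verbatim the `let Ω` of
`LeftRightFKG`. [folklore] -/
def dom {c : Site 2} (C : (zdGraph 2).Walk c c) (δ : ℝ) : Set ℂ :=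
  {z | Literature.Topology.PlaneTopology.wind
    (fun t : ℝ => Set.IccExtend zero_le_one (C.toCurve (meshPoint δ)) t - z) ≠ 0}

/-- The crux's left–right order — verbatim the `let le` of `LeftRightFKG`: the lens loop `γ₁ · γ₂⁻¹`
has winding number `≥ 0` about every point. [folklore] -/
def lrLE {Ω : Set ℂ} {δ : ℝ} {a b : Site 2} (γ₁ γ₂ : SAW.DomainSAW Ω δ a b) : Prop :=
  ∀ z : ℂ, 0 ≤ Literature.Topology.PlaneTopology.wind (fun t : ℝ =>
    Set.IccExtend zero_le_one ((γ₁.walk.append γ₂.walk.reverse).toCurve (meshPoint δ)) t - z)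

/-- `LeftRightFKG` is the PA clause for every admissible `(δ, C, a, b)` (definitional). [folklore] -/
theorem leftRightFKG_iff_PAClause :
    LeftRightFKG ↔ ∀ (δ : ℝ) (c a b a' b' : Site 2) (C : (zdGraph 2).Walk c c), 0 < δ →
      a' ∈ C.support → b' ∈ C.support → (zdGraph 2).Adj a a' → (zdGraph 2).Adj b b' →
        PAClause (lrLE (Ω := dom C δ) (δ := δ) (a := a) (b := b)) (SAW.weight (dom C δ) δ a b) :=
  Iff.rfl

/-- **Two distinct maximal elements kill the PA clause** for any measure charging both: `A = {m₁}` and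
`B = {m₂}` are up-closed and `w{m₁}·w{m₂} ≤ w(univ)·w(∅) = 0` is false.  (Dually for two minimal
elements, by the complement identity.) [folklore] -/
theorem not_PAClause_of_two_maximal {ι : Type*} [MeasurableSpace ι] {le : ι → ι → Prop} {w : Measure ι}
    {m₁ m₂ : ι} (hne : m₁ ≠ m₂) (h₁ : ∀ γ, le m₁ γ → γ = m₁) (h₂ : ∀ γ, le m₂ γ → γ = m₂)
    (hw₁ : w {m₁} ≠ 0) (hw₂ : w {m₂} ≠ 0) : ¬ PAClause le w := by
  intro h
  have hA : ∀ γ₁ γ₂, le γ₁ γ₂ → γ₁ ∈ ({m₁} : Set ι) → γ₂ ∈ ({m₁} : Set ι) := by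
    intro γ₁ γ₂ hle hγ₁
    rw [Set.mem_singleton_iff] at hγ₁ ⊢
    subst hγ₁
    exact h₁ _ hle
  have hB : ∀ γ₁ γ₂, le γ₁ γ₂ → γ₁ ∈ ({m₂} : Set ι) → γ₂ ∈ ({m₂} : Set ι) := by
    intro γ₁ γ₂ hle hγ₁
    rw [Set.mem_singleton_iff] at hγ₁ ⊢
    subst hγ₁
    exact h₂ _ hle
  have key := h {m₁} {m₂} hA hB
  have hint : ({m₁} : Set ι) ∩ {m₂} = ∅ := by
    rw [Set.singleton_inter_eq_empty, Set.mem_singleton_iff]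
    exact hne
  rw [hint, measure_empty, mul_zero, nonpos_iff_eq_zero, mul_eq_zero] at key
  exact key.elim hw₁ hw₂

/-- Every single chord has nonzero critical weight `x_c^{|γ|}` (`0 < x_c`, proved in tree). [folklore] -/
theorem weight_singleton_ne_zero {Ω : Set ℂ} {δ : ℝ} {a b : Site 2} (γ : SAW.DomainSAW Ω δ a b) :
    SAW.weight Ω δ a b {γ} ≠ 0 := by
  rw [SAW.weight_singleton]
  exact (ENNReal.ofReal_pos.2 (pow_pos SAW.criticalFugacity_pos_lt_one'.1 _)).ne'

/-- Hence, on the crux's own carrier: two distinct `≼`-maximal chords refute the PA clause for that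
`(Ω, a, b)` at the critical fugacity (and, verbatim, at every positive fugacity). [folklore] -/
theorem not_PAClause_weight_of_two_maximal {Ω : Set ℂ} {δ : ℝ} {a b : Site 2}
    {m₁ m₂ : SAW.DomainSAW Ω δ a b} (hne : m₁ ≠ m₂)
    (h₁ : ∀ γ, lrLE m₁ γ → γ = m₁) (h₂ : ∀ γ, lrLE m₂ γ → γ = m₂) :
    ¬ PAClause (lrLE (Ω := Ω) (δ := δ) (a := a) (b := b)) (SAW.weight Ω δ a b) :=
  not_PAClause_of_two_maximal hne h₁ h₂ (weight_singleton_ne_zero m₁) (weight_singleton_ne_zero m₂)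

/-! ## §4 The mutated hypotheses the scheme would need at deep endpoints -/

/-- PA with the boundary-adjacency of BOTH endpoints dropped — what step (i) of the scheme would need
at time zero for an endpoint approximation with deep start and deep target. [folklore] -/
def LeftRightFKGFree : Prop :=
  ∀ (δ : ℝ) (c a b : Site 2) (C : (zdGraph 2).Walk c c), 0 < δ →
    PAClause (lrLE (Ω := dom C δ) (δ := δ) (a := a) (b := b)) (SAW.weight (dom C δ) δ a b)

/-- PA with the adjacency of the TARGET only dropped — what the scheme needs after conditioning on a
past (tip adjacent to the past) when the target `b_δ` is deep. [folklore] -/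
def LeftRightFKGFreeTarget : Prop :=
  ∀ (δ : ℝ) (c a b a' : Site 2) (C : (zdGraph 2).Walk c c), 0 < δ → a' ∈ C.support →
    (zdGraph 2).Adj a a' →
      PAClause (lrLE (Ω := dom C δ) (δ := δ) (a := a) (b := b)) (SAW.weight (dom C δ) δ a b)

/-- The free form implies the target-free form, which implies the crux's hypothesis. [folklore] -/
theorem freeTarget_of_free (h : LeftRightFKGFree) : LeftRightFKGFreeTarget :=
  fun δ c a b _ C hδ _ _ => h δ c a b C hδ

/-- [folklore] -/
theorem leftRightFKG_of_freeTarget (h : LeftRightFKGFreeTarget) : LeftRightFKG :=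
  fun δ c a b a' _ C hδ ha' _ haa' _ => h δ c a b a' C hδ ha' haa'

/-- The finite witness that kills `LeftRightFKGFree`: an admissible carrier with two distinct maximal
chords.  COMPUTED instances (job1/lrposet.py, exact): 5×5 box with a=(2,2), b=(3,3) has 7 maximal and
7 minimal chords among 3762; a=(1,1), b=(3,3): 6/6; the punctured box 5×5∖{(1,1)} (first-step
conditioning of a deep start) with tip a=(2,1) and deep target b=(3,3): 4/3 among 1065.  Typing the
witness in Lean needs the winding numbers of explicit lattice lens loops (doable with
`ArgumentIncrement`/`wind_concatPath_mul`, not attempted this cycle). [folklore] -/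
def TwoMaxFree : Prop :=
  ∃ (δ : ℝ) (c a b : Site 2) (C : (zdGraph 2).Walk c c) (m₁ m₂ : SAW.DomainSAW (dom C δ) δ a b),
    0 < δ ∧ m₁ ≠ m₂ ∧ (∀ γ, lrLE m₁ γ → γ = m₁) ∧ (∀ γ, lrLE m₂ γ → γ = m₂)

/-- Modulo the finite winding computation `TwoMaxFree`, the adjacency-free PA is FALSE (at every
fugacity): the scheme has no positively associated object at time zero for deep–deep endpoint
approximations. [folklore] -/
theorem not_leftRightFKGFree_of_twoMax (h : TwoMaxFree) : ¬ LeftRightFKGFree := by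
  rintro hfree
  obtain ⟨δ, c, a, b, C, m₁, m₂, hδ, hne, h₁, h₂⟩ := h
  exact not_PAClause_weight_of_two_maximal hne h₁ h₂ (hfree δ c a b C hδ)

/-! ## §5 Junk audit of the conclusion — imported from the sibling crux `TPToTraversalBound` -/

section Sibling
open Summit.CriticalPhenomena.SAWScalingLimit.Theorems.TPToTraversalBound

/-- The two routes' `SAWTraversalBound` decls are the same statement (definitional). [folklore] -/
theorem traversalBound_iff_TP :
    SAWTraversalBound ↔ Summit.CriticalPhenomena.SAWScalingLimit.Theses.SAWTotalPositivity.SAWTraversalBound :=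
  Iff.rfl

/-- Imported certified facts (sibling, landed as `Theorems/TPToTraversalBound/Negative/{Logic,DeepStart}`): mass ≤ 1, all-δ ↔ eventual, threshold may be
raised above any prescribed function, deep starts are admissible endpoint approximations. [folklore] -/
theorem sibling_audit :
    (∀ (Ω : Set ℂ) (δ : ℝ) (u v : Site 2) (S : Set (SAW.DomainSAW Ω δ u v)), SAW.law Ω δ u v S ≤ 1) ∧
    (Negative.AllMeshTraversalBound ↔ SAWTraversalBound) ∧
    (∃ a b : ℝ → Site 2, SAW.IsEndpointApprox DobrushinDomain.unitDisc a b ∧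
      ∀ δ : ℝ, 0 < δ → δ ≤ 1 / 16 →
        Metric.ball (meshPoint δ (a δ)) (Real.sqrt δ) ⊆ DobrushinDomain.unitDisc.carrier) :=
  ⟨Negative.law_apply_le_one, Negative.allMesh_iff, Negative.exists_isEndpointApprox_deepStart⟩

end Sibling

/-! ## §6 No floating holes in the domains of `LeftRightFKG` (certified; landing as `Theorems/FKGToTraversalBound/Negative/DeepEndpointGap.lean`) -/

/-- `wind` takes the junk value `0` when no continuous logarithm exists. [folklore] -/
theorem wind_eq_zero_of_not_hasLogOn {f : ℝ → ℂ} (h : ¬ HasLogOn f (Icc 0 1)) : wind f = 0 := by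
  rw [wind, dif_neg (fun h' => h h'.1)]

/-- A loop through `z` has winding (junk) `0` about `z`. [folklore] -/
theorem wind_sub_eq_zero_of_mem_range {γ : C(unitInterval, ℂ)} {z : ℂ} (hz : z ∈ Set.range γ) :
    wind (fun t : ℝ => Set.IccExtend zero_le_one γ t - z) = 0 := by
  apply wind_eq_zero_of_not_hasLogOn
  intro h
  obtain ⟨t, ht⟩ := hz
  have := h.ne_zero (x := (t : ℝ)) ⟨t.2.1, t.2.2⟩
  apply this
  simp only [Set.IccExtend_val, ht, sub_self]

/-- A loop confined to the closed half-plane `{re ≤ M}` does not wind about a point with `re > M`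
(`w ↦ w − z` has the continuous logarithm `log (z − w) + iπ` there). [folklore] -/
theorem wind_sub_eq_zero_of_re_le {γ : C(unitInterval, ℂ)} {M : ℝ} (hγ : ∀ s, (γ s).re ≤ M)
    {z : ℂ} (hz : M < z.re) (h01 : γ 0 = γ 1) :
    wind (fun t : ℝ => Set.IccExtend zero_le_one γ t - z) = 0 := by
  have hF : HasLogOn (fun w : ℂ => w - z) {w : ℂ | w.re ≤ M} := by
    refine ⟨fun w => Complex.log (z - w) + Real.pi * Complex.I, ?_, ?_⟩
    · refine ContinuousOn.add ?_ continuousOn_const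
      refine (ContinuousOn.sub continuousOn_const continuousOn_id).clog ?_
      intro w hw
      have hw' : w.re ≤ M := hw
      rw [Complex.mem_slitPlane_iff]
      left
      simp
      linarith
    · intro w hw
      have hw' : w.re ≤ M := hw
      have hne : z - w ≠ 0 := by
        intro h0
        have := congrArg Complex.re h0
        simp only [Complex.sub_re, Complex.zero_re] at this
        linarith
      rw [Complex.exp_add, Complex.exp_log hne, Complex.exp_pi_mul_I]
      ring
  have hcont : Continuous fun t : ℝ => Set.IccExtend zero_le_one γ t := γ.continuous.Icc_extend'
  have := wind_comp_eq_zero_of_hasLogOn (γ := fun t : ℝ => Set.IccExtend zero_le_one γ t) hF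
    hcont.continuousOn ?_ ?_
  · exact this
  · intro t ht
    show (Set.IccExtend zero_le_one γ t).re ≤ M
    rw [Set.IccExtend_of_mem _ _ ht]
    exact hγ _
  · show Set.IccExtend zero_le_one γ 0 = Set.IccExtend zero_le_one γ 1
    rw [Set.IccExtend_left, Set.IccExtend_right]
    exact h01

/-- The vertices of the boundary walk are NOT sites of the domain (they lie on the trace, where `wind` is
the junk `0`). [folklore] -/
theorem notMem_dom_of_mem_support {c : Site 2} (C : (zdGraph 2).Walk c c) (δ : ℝ) {x : Site 2}
    (hx : x ∈ C.support) : meshPoint δ x ∉ dom C δ := by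
  simp only [dom, Set.mem_setOf_eq, not_not]
  exact wind_sub_eq_zero_of_mem_range (C.mem_range_toCurve (meshPoint δ) hx)

/-- A site strictly to the right of every vertex of the boundary walk is NOT a site of the domain. [folklore] -/
theorem notMem_dom_of_forall_lt {c : Site 2} (C : (zdGraph 2).Walk c c) {δ : ℝ} (hδ : 0 < δ)
    {y : Site 2} (hy : ∀ x ∈ C.support, x 0 < y 0) : meshPoint δ y ∉ dom C δ := by
  simp only [dom, Set.mem_setOf_eq, not_not]
  have hsub : Set.range (C.toCurve (meshPoint δ)) ⊆ {w : ℂ | w.re ≤ δ * ((y 0 : ℝ) - 1)} := by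
    refine SimpleGraph.Walk.range_toCurve_subset C ?_ ?_
    · show (meshPoint δ c).re ≤ δ * ((y 0 : ℝ) - 1)
      rw [meshPoint_re]
      have := hy c C.start_mem_support
      have : (c 0 : ℝ) ≤ (y 0 : ℝ) - 1 := by exact_mod_cast Int.le_sub_one_of_lt this
      exact mul_le_mul_of_nonneg_left this hδ.le
    · intro d hd
      refine (convex_halfSpace_re_le _).segment_subset ?_ ?_
      · show (meshPoint δ d.fst).re ≤ δ * ((y 0 : ℝ) - 1)
        rw [meshPoint_re]
        have := hy _ (C.dart_fst_mem_support_of_mem_darts hd)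
        have : (d.fst 0 : ℝ) ≤ (y 0 : ℝ) - 1 := by exact_mod_cast Int.le_sub_one_of_lt this
        exact mul_le_mul_of_nonneg_left this hδ.le
      · show (meshPoint δ d.snd).re ≤ δ * ((y 0 : ℝ) - 1)
        rw [meshPoint_re]
        have := hy _ (C.dart_snd_mem_support_of_mem_darts hd)
        have : (d.snd 0 : ℝ) ≤ (y 0 : ℝ) - 1 := by exact_mod_cast Int.le_sub_one_of_lt this
        exact mul_le_mul_of_nonneg_left this hδ.le
  refine wind_sub_eq_zero_of_re_le (M := δ * ((y 0 : ℝ) - 1)) (fun s => hsub ⟨s, rfl⟩) ?_ ?_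
  · rw [meshPoint_re]
    nlinarith
  · rw [SimpleGraph.Walk.toCurve_apply_zero, SimpleGraph.Walk.toCurve_apply_one]

/-- **No floating holes.**  Every vertex `v` of the boundary walk `C` is joined by a lattice walk whose
vertices all lie OUTSIDE the domain `{x | δx ∈ Ω(C, δ)}` to a site strictly to the right of every vertex of
`C` (follow `C` to its vertex of maximal abscissa, then one step east).  Hence the complement of an r2
lattice domain is connected "to infinity" through the trace: the components of `{wind ≠ 0}` enclose no
lattice site that is not theirs. [folklore] -/
theorem noFloatingHoles {c : Site 2} (C : (zdGraph 2).Walk c c) {δ : ℝ} (hδ : 0 < δ)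
    {v : Site 2} (hv : v ∈ C.support) :
    ∃ (u : Site 2) (p : (zdGraph 2).Walk v u), (∀ x ∈ C.support, x 0 < u 0) ∧
      ∀ x ∈ p.support, meshPoint δ x ∉ dom C δ := by
  classical
  obtain ⟨E, hE, hEmax⟩ := C.support.toFinset.exists_max_image (fun x : Site 2 => x 0)
    ⟨c, List.mem_toFinset.2 C.start_mem_support⟩
  have hE' : E ∈ C.support := List.mem_toFinset.1 hE
  set u : Site 2 := E + Pi.single 0 1 with hu
  have hadj : (zdGraph 2).Adj E u := (zdGraph_adj_iff _ _).2 ⟨0, Or.inl rfl⟩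
  have hu0 : u 0 = E 0 + 1 := by simp [hu]
  have hlt : ∀ x ∈ C.support, x 0 < u 0 := by
    intro x hx
    have := hEmax x (List.mem_toFinset.2 hx)
    omega
  let q : (zdGraph 2).Walk v E := (C.takeUntil v hv).reverse.append (C.takeUntil E hE')
  have hq : ∀ x ∈ q.support, x ∈ C.support := by
    intro x hx
    rw [SimpleGraph.Walk.support_append, List.mem_append, SimpleGraph.Walk.support_reverse,
      List.mem_reverse] at hx
    rcases hx with hx | hx
    · exact C.support_takeUntil_subset_support hv hx
    · exact C.support_takeUntil_subset_support hE' (List.tail_subset _ hx)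
  refine ⟨u, q.append (SimpleGraph.Walk.cons hadj SimpleGraph.Walk.nil), hlt, ?_⟩
  intro x hx
  rw [SimpleGraph.Walk.support_append, List.mem_append] at hx
  rcases hx with hx | hx
  · exact notMem_dom_of_mem_support C δ (hq x hx)
  · simp only [SimpleGraph.Walk.support_cons, SimpleGraph.Walk.support_nil, List.tail_cons,
      List.mem_singleton] at hx
    subst hx
    exact notMem_dom_of_forall_lt C hδ hlt

/-- **The first-step device cannot present a punctured domain.**  If all four lattice neighbours of a
vertex `v` of the boundary walk `C` are sites of the domain, contradiction: so a lattice site set `S` in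
which some `v` is ENCLOSED (every `ℤ²`-neighbour of `v` lies in `S`) is never the site set of an r2 domain
whose boundary walk passes through `v`.  Applied to `S = Ω_δ ∖ {a_δ}` (deep start `a_δ`, tip adjacent to
`a' = a_δ ∈ C.support` as the scheme proposes): `LeftRightFKG` is not instantiable there. [folklore] -/
theorem not_presentable_of_enclosed {c : Site 2} (C : (zdGraph 2).Walk c c) {δ : ℝ} (hδ : 0 < δ)
    {v : Site 2} (hv : v ∈ C.support) {S : Set (Site 2)} (hS : ∀ w, (zdGraph 2).Adj v w → w ∈ S) :
    S ≠ {x | meshPoint δ x ∈ dom C δ} := by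
  intro hSeq
  obtain ⟨u, p, hlt, hp⟩ := noFloatingHoles C hδ hv
  have huv : v ≠ u := by
    intro h
    have := hlt v hv
    rw [h] at this
    exact lt_irrefl _ this
  cases p with
  | nil => exact huv rfl
  | cons hadj p' =>
    rename_i w
    have hw : w ∈ S := hS w hadj
    rw [hSeq] at hw
    exact hp w (by simp) hw


/-! ## §8 (cycle 2) Structure of ADMISSIBLE carriers: `≼` is crossing dominance and has a top and a bottom (F5)

**Theorem F5 (proved on paper this cycle; not yet formalised).**  Let `(δ, C, a, b)` be admissible for
`LeftRightFKG` (`a ∼ a' ∈ C.support`, `b ∼ b' ∈ C.support`) with at least one chord, `S := meshDomain Ω δ`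
(`Ω = dom C δ`), `T := ℤ² ∖ S`, `G := ℤ²[S]` (= `discreteDomainGraph`, an INDUCED subgraph: an edge between two
sites of `Ω` never meets the trace).  Then:
 (i) `T` is 4-connected (every `T`-site adjacent to `S` is ON the trace — else it shares four off-trace faces
     with an `S`-site and has the same non-zero index; the trace is connected and its max-abscissa vertex steps
     into the exterior: `noFloatingHoles`, §6); hence `T ∪ {T–T edges}` is a connected subset of
     `ℂ ∖ drawing(G)` reaching infinity, i.e. ALL of `T` lies in the unbounded face `F∞` of the plane graph `G`;
     `a, b ∈ ∂F∞` (the open edge `(a, a')` lies in `F∞`);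
 (ii) every BOUNDED face of `G` is an open unit square with its four corners in `S` (a bounded face containing
     a lattice point or an open lattice edge would meet `F∞`, by inducedness);
 (iii) for chords `γ₁, γ₂` the lens `ℓ = γ₁·γ₂⁻¹` has `wind(ℓ, z) = 0` on `F∞` (connected, unbounded, misses the
     trace), junk `0` on the trace, and on each bounded face / open `G`-edge / `S`-site off the trace the value at
     an incident face centre; so `le γ₁ γ₂ ⟺ ∀ unit faces f ⊆ S: wind(ℓ, centre f) ≥ 0 ⟺ ∀ f:
     wcross_f γ₁ ≤ wcross_f γ₂` (r2-disprover's bridge `LeftRightFKG.Negative.wind_poly_probeL` /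
     `wcross_le_of_wind_nonneg`, p76216) — `≼` IS facewise dominance of crossing counts, a partial order
     (antisymmetric: `w ≡ 0` ⇒ the 1-cycle `γ₁ − γ₂` bounds the zero 2-chain ⇒ equal directed edge sets ⇒
     equal simple paths);
 (iv) **TOP AND BOTTOM EXIST.**  Let `ω` be the facial walk of `F∞` from `a` to `b` with `F∞` on its left and
     `U := ` its chronological loop-erasure (a chord; its directed edges are directed edges of `ω`, each with
     `F∞` on its left).  For any chord `P` let `w` be the winding 2-chain of the 1-cycle `U − P` (`w = 0` on
     `F∞`; across a directed edge `e`, `w(left e) − w(right e) = (U − P)(e)`).  If `M := max w > 0`, the face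
     set `Q := {w = M}` is bounded and every edge of `∂Q` (oriented with `Q` on its left) has
     `(U − P)(e) ≥ 1`; a forward `U`-edge with a bounded face on its left is impossible, so every edge of `∂Q`
     is an edge of `P` (traversed with `Q` on its right).  But `∂Q ≠ ∅` is a 1-cycle and the edge set of the
     simple path `P` is acyclic — contradiction.  Hence `w ≤ 0`, i.e. `U` is an extremum comparable with EVERY
     chord; the reversed facial walk gives the other extremum.  ∎
CONSEQUENCES.  (a) the weight-free kill of §3 (`not_PAClause_of_two_maximal`) can never fire on an admissible
carrier (`maximal_unique_of_top` below): `LeftRightFKG` can only die through the weights, consistent with all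
enumeration (r2 Disproof E1: 87 789 admissible posets ≤ 11 sites, 0 violations at every `x ≤ .55`; this seat:
all admissible pairs on 5×4, needled 5×5/6×4, slit 5×5 — unique top/bottom throughout); (b) "kissing corners"
break only binary `∨/∧` (the right envelope of two chords may touch itself), never `⊤/⊥`; (c) the proof uses
exactly `a, b ∈ ∂F∞` — for a deep endpoint no `U` exists, which is the mechanism behind F3/E6 (several maximal
chords, spirals round the deep point). -/

/-- `t` is a top of the chord poset. [folklore] -/
def IsTop {Ω : Set ℂ} {δ : ℝ} {a b : Site 2} (t : SAW.DomainSAW Ω δ a b) : Prop := ∀ γ, lrLE γ t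

/-- `s` is a bottom of the chord poset. [folklore] -/
def IsBot {Ω : Set ℂ} {δ : ℝ} {a b : Site 2} (s : SAW.DomainSAW Ω δ a b) : Prop := ∀ γ, lrLE s γ

/-- A maximal element below a top is the top. [folklore] -/
theorem eq_of_isTop_of_maximal {Ω : Set ℂ} {δ : ℝ} {a b : Site 2} {t m : SAW.DomainSAW Ω δ a b}
    (ht : IsTop t) (hm : ∀ γ, lrLE m γ → γ = m) : t = m :=
  hm t (ht m)

/-- With a top, `≼`-maximal chords are unique: on admissible carriers (F5 (iv)) the two-maximal kill of §3 is
unavailable, so `LeftRightFKG` can only be refuted through the weights. [folklore] -/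
theorem maximal_unique_of_top {Ω : Set ℂ} {δ : ℝ} {a b : Site 2} {t m₁ m₂ : SAW.DomainSAW Ω δ a b}
    (ht : IsTop t) (h₁ : ∀ γ, lrLE m₁ γ → γ = m₁) (h₂ : ∀ γ, lrLE m₂ γ → γ = m₂) : m₁ = m₂ :=
  (eq_of_isTop_of_maximal ht h₁).symm.trans (eq_of_isTop_of_maximal ht h₂)

/-- Dually for minimal chords below a bottom. [folklore] -/
theorem minimal_unique_of_bot {Ω : Set ℂ} {δ : ℝ} {a b : Site 2} {s m₁ m₂ : SAW.DomainSAW Ω δ a b}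
    (hs : IsBot s) (h₁ : ∀ γ, lrLE γ m₁ → γ = m₁) (h₂ : ∀ γ, lrLE γ m₂ → γ = m₂) : m₁ = m₂ :=
  (h₁ s (hs m₁)).symm.trans (h₂ s (hs m₂))

/-- **F5 (iv) as a `Prop`** (paper proof above; formalisation route: the Stokes relation for `wcross` across an
edge of the 1-cycle `U − P` + the argmax-region argument, on top of `LeftRightFKG.Negative.LatticePolylines`):
every admissible carrier with a chord has a top and a bottom. [folklore] -/
def AdmissibleHasTopBot : Prop :=
  ∀ (δ : ℝ) (c a b a' b' : Site 2) (C : (zdGraph 2).Walk c c), 0 < δ → a' ∈ C.support → b' ∈ C.support →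
    (zdGraph 2).Adj a a' → (zdGraph 2).Adj b b' → Nonempty (SAW.DomainSAW (dom C δ) δ a b) →
      ∃ t s : SAW.DomainSAW (dom C δ) δ a b, IsTop t ∧ IsBot s

/-! ## §9 (cycle 2) The repair R1 typed, and a CERTIFIED member of the deep fragment

`SAWTraversalBoundBdry` = (H1) restricted to endpoint approximations that are eventually lattice-boundary
vertices (`meshBoundary`: some `ℤ²`-neighbour not joined in `Ω_δ`) — the only approximations whose time-zero
carrier (and, by the domain Markov property, every later carrier) is admissible for `LeftRightFKG`.
`DeepEndpointReduction` = the missing item.  `crux_iff_split`: the crux is EXACTLY the R1-crux plus the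
reduction (given PA).  `exists_isEndpointApprox_not_bdryApprox`: the R1 class omits an admissible endpoint
approximation of the unit disc (the sibling's depth-`√δ` start, all four neighbours joined in `Ω_δ`), so the
reduction has content and the typed crux is strictly more than the mechanism's reach. -/

open Filter Topology

/-- (H1) for ONE endpoint approximation — verbatim the body of `SAWTraversalBound`. [folklore] -/
def H1At (D : DobrushinDomain) (a b : ℝ → Site 2) : Prop :=
  ∃ (k : ℂ → ℝ → ℝ → ℕ) (K lam δ₀ : ℝ), 0 ≤ K ∧ 2 < lam ∧ 0 < δ₀ ∧ ∀ δ ∈ Set.Ioc (0 : ℝ) δ₀,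
    ∀ (x : ℂ) (ρ R : ℝ), δ ≤ ρ → ρ < R → R ≤ 1 →
      SAW.law D.carrier δ (a δ) (b δ)
        {γ | (⟨γ.walk.toCurve (meshPoint δ)⟩ : Curve ℂ).HasTraversals (k x ρ R) x ρ R} ≤
        ENNReal.ofReal (K * (ρ / R) ^ lam)

/-- (H1) is `H1At` for every endpoint approximation (definitional). [folklore] -/
theorem traversalBound_iff_H1At :
    SAWTraversalBound ↔ ∀ (D : DobrushinDomain) (a b : ℝ → Site 2), SAW.IsEndpointApprox D a b → H1At D a b :=
  Iff.rfl

/-- The R1 class: both lattice endpoints are eventually vertices of the lattice boundary of `Ω_δ`. [folklore] -/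
def BdryApprox (D : DobrushinDomain) (a b : ℝ → Site 2) : Prop :=
  ∀ᶠ δ in 𝓝[>] (0 : ℝ), a δ ∈ meshBoundary D.carrier δ ∧ b δ ∈ meshBoundary D.carrier δ

/-- STATEMENT VARIANT: (H1) restricted to the R1 class (repair R1 of F3). -/
def SAWTraversalBoundBdry : Prop :=
  ∀ (D : DobrushinDomain) (a b : ℝ → Site 2), SAW.IsEndpointApprox D a b → BdryApprox D a b → H1At D a b

/-- STATEMENT VARIANT: the crux restricted to the R1 class — what the PA/RSW mechanism can at best deliver. -/
def FKGToTraversalBoundBdry : Prop := LeftRightFKG → SAWTraversalBoundBdry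

/-- STATEMENT VARIANT (open reduction, candidate route item): boundary-endpoint (H1) ⇒ (H1) for all endpoint
approximations (needs near-start / near-target return estimates for deep marked points: 3 legs,
`x₃ − x₁ = 3/2 < 2`, so `k ≥ 4` there). -/
def DeepEndpointReduction : Prop := SAWTraversalBoundBdry → SAWTraversalBound

/-- [folklore] -/
theorem traversalBoundBdry_of_traversalBound (h : SAWTraversalBound) : SAWTraversalBoundBdry :=
  fun D a b hab _ => h D a b hab

/-- The crux implies its R1 restriction. [folklore] -/
theorem bdryCrux_of_crux (h : FKGToTraversalBound) : FKGToTraversalBoundBdry :=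
  fun hl => traversalBoundBdry_of_traversalBound (h hl)

/-- R1-crux + reduction ⇒ crux. [folklore] -/
theorem crux_of_bdryCrux (h₁ : FKGToTraversalBoundBdry) (h₂ : DeepEndpointReduction) : FKGToTraversalBound :=
  fun hl => h₂ (h₁ hl)

/-- **The split is exact**: crux ⟺ R1-crux ∧ (PA → reduction). [folklore] -/
theorem crux_iff_split :
    FKGToTraversalBound ↔ FKGToTraversalBoundBdry ∧ (LeftRightFKG → DeepEndpointReduction) :=
  ⟨fun h => ⟨bdryCrux_of_crux h, fun hl _ => h hl⟩, fun h hl => h.2 hl (h.1 hl)⟩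

/-- `meshDomain` is a union of components: it is closed under mesh-adjacency. [folklore] -/
theorem mem_meshDomain_of_adj {Ω : Set ℂ} {δ : ℝ} {x y : Site 2} (hx : x ∈ meshDomain Ω δ)
    (hy : y ∈ meshVertices Ω δ) (hxy : (meshGraph Ω δ).Adj x y) : y ∈ meshDomain Ω δ := by
  simp only [meshDomain, Set.mem_iUnion, Set.mem_image] at hx ⊢
  obtain ⟨K, hK, x', hx'K, hx'x⟩ := hx
  refine ⟨K, hK, ⟨y, hy⟩, ?_, rfl⟩
  rw [SimpleGraph.ConnectedComponent.mem_supp_iff] at hx'K ⊢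
  rw [← hx'K]
  have hadj : (meshVertexGraph Ω δ).Adj ⟨y, hy⟩ x' := by
    simp only [SimpleGraph.comap_adj, Function.Embedding.coe_subtype, hx'x]
    exact hxy.symm
  exact SimpleGraph.ConnectedComponent.sound hadj.reachable

/-- A site whose `√δ`-ball lies inside `Ω` is NOT a lattice-boundary vertex (`0 < δ < 1`): all four
neighbours are mesh vertices joined to it by edges inside `Ω̄`, hence in the same component. [folklore] -/
theorem not_mem_meshBoundary_of_ball_subset {Ω : Set ℂ} {δ : ℝ} (hδ : 0 < δ) (hδ1 : δ < 1) {x : Site 2}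
    (hball : Metric.ball (meshPoint δ x) (Real.sqrt δ) ⊆ Ω) : x ∉ meshBoundary Ω δ := by
  intro hx
  rw [mem_meshBoundary_iff] at hx
  obtain ⟨hxD, y, hxy, hnadj⟩ := hx
  apply hnadj
  have hδs : δ < Real.sqrt δ := by
    rw [Real.lt_sqrt hδ.le]
    nlinarith
  have hyball : meshPoint δ y ∈ Metric.ball (meshPoint δ x) (Real.sqrt δ) := by
    rw [Metric.mem_ball, dist_eq_norm]
    calc ‖meshPoint δ y - meshPoint δ x‖
        ≤ |(meshPoint δ y - meshPoint δ x).re| + |(meshPoint δ y - meshPoint δ x).im| :=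
          Complex.norm_le_abs_re_add_abs_im _
      _ = δ := (abs_re_im_meshPoint_sub_of_adj hδ.le hxy).2.2
      _ < Real.sqrt δ := hδs
  have hxball : meshPoint δ x ∈ Metric.ball (meshPoint δ x) (Real.sqrt δ) :=
    Metric.mem_ball_self (Real.sqrt_pos.2 hδ)
  have hseg : segment ℝ (meshPoint δ x) (meshPoint δ y) ⊆ closure Ω :=
    ((convex_ball _ _).segment_subset hxball hyball).trans (hball.trans subset_closure)
  have hmadj : (meshGraph Ω δ).Adj x y := meshGraph_adj_iff.2 ⟨hxy, hseg⟩
  have hyV : y ∈ meshVertices Ω δ := hball hyball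
  exact discreteDomainGraph_adj_iff.2 ⟨hmadj, hxD, mem_meshDomain_of_adj hxD hyV hmadj⟩

section DeepFragment
open Summit.CriticalPhenomena.SAWScalingLimit.Theorems.TPToTraversalBound

/-- **The R1 class omits an admissible endpoint approximation** (certified): the sibling's depth-`√δ` approximation
of the unit disc is an `IsEndpointApprox` whose start is, for every `δ ≤ 1/16`, NOT a lattice-boundary vertex.
Hence `SAWTraversalBoundBdry` quantifies over strictly fewer approximations than `SAWTraversalBound`, and
`DeepEndpointReduction` is a genuine item. [folklore] -/
theorem exists_isEndpointApprox_not_bdryApprox :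
    ∃ a b : ℝ → Site 2, SAW.IsEndpointApprox DobrushinDomain.unitDisc a b ∧
      ¬ BdryApprox DobrushinDomain.unitDisc a b := by
  obtain ⟨a, b, hab, hdeep⟩ := Negative.exists_isEndpointApprox_deepStart
  refine ⟨a, b, hab, fun hbd => ?_⟩
  have hsmall : Set.Ioc (0 : ℝ) (1 / 16) ∈ 𝓝[>] (0 : ℝ) := Ioc_mem_nhdsGT (by norm_num)
  obtain ⟨δ, ⟨hmb, -⟩, hδ0, hδ1⟩ := (hbd.and hsmall).exists
  exact not_mem_meshBoundary_of_ball_subset hδ0 (by linarith) (hdeep δ hδ0 hδ1) hmb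

/-- So the R1 hypothesis `BdryApprox` is not vacuous-by-exhaustion: `SAWTraversalBound` is NOT syntactically the
same as `SAWTraversalBoundBdry` (one approximation of the disc separates the binders). [folklore] -/
theorem exists_approx_outside_R1 :
    ¬ ∀ (D : DobrushinDomain) (a b : ℝ → Site 2), SAW.IsEndpointApprox D a b → BdryApprox D a b := by
  intro h
  obtain ⟨a, b, hab, hnot⟩ := exists_isEndpointApprox_not_bdryApprox
  exact hnot (h _ a b hab)

end DeepFragment

/-! ## §10 (cycle 2) Exact status of PA on the carriers the scheme would need off the R1 class (computed)

All numbers: exhaustive enumeration of chords, order = facewise crossing dominance (F5 (iii); ALL unit faces of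
the bounding box are used, so faces of a floating hole — where the lens winding is a genuine constraint — are
included, and faces of boundary-attached slits are harmlessly redundant), weights `x^{|γ|}`, screening over the
family {elementary up/down-sets `{θ_f ≥ c}` / `{θ_f ≤ c}`, every face and level} ∪ {principal up/down-sets of the
30–40 shortest and 15–20 longest chords}: all same-type pairs (want `w(A∩B)w(Ω)/(w(A)w(B)) ≥ 1`) and all mixed
pairs (want `≤ 1`) in long double, then the extremal pair of each kind RE-EVALUATED IN EXACT RATIONAL ARITHMETIC
at `x ∈ {10/27, 3790522777·10⁻¹⁰, 10/26}` (session folder `c/lrc.c` + `c/exactify.py`, cross-checked against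
the independent pure-python `py/lr.py` on 5×4; kit jobs j011834 (6×5 full + 6×6, 108 cases) and j011835 (7×5 +
floating-slit families, 70 cases) queued behind a saturated farm at publication — their summaries auto-attach
to the item; the decisive subset below was run niced in-session).
* **F6 — ONE deep endpoint (boundary start, deep TARGET = `LeftRightFKGFreeTarget`, §4): PA HOLDS on every
  instance; margins positive but vanishing.**  `a` with a neighbour outside `S`, `b` with all EIGHT king-neighbours
  inside: 5×4 (24 carriers, N ≤ 738), 5×5 (42, N ≤ 4 330), 6×4 (32, N ≤ 10⁴), 6×5 (60 = every boundary start up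
  to symmetry × every interior target, N ≤ 6.4·10⁴), 6×6 (48 = D₄-orbit representatives of the start × all 16
  interior targets, N = 5.7·10⁵ … 1.03·10⁶ chords; kit j011834, done): 0 violations on 206 carriers; minimum exact
  same-type ratio − 1 = `+2.5·10⁻⁸` (5×4), `+1.4·10⁻¹⁰` (5×5), `+4.6·10⁻¹⁰` (6×4), `+1.1·10⁻¹²` (6×5), `+3.7·10⁻¹⁵`
  (6×6); mixed pairs `≤ 1` exactly (least-negative exact margins `−6·10⁻²⁴ … −5·10⁻²⁶`: near-factorisation across
  the box).  Top and
  bottom UNIQUE in every instance where computed (N ≤ 4 330), in 432 random one-deep box carriers with bites /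
  needles (`py/search_1deep_multimax.py`, seed 7) and in 8 608 random accreted simply connected polyominoes of
  12–24 sites grown round a 3×3 core (`py/search_1deep_poly.py`, seed 11): 0 multi-extremal — although F5's
  proof does not apply (`b ∉ ∂F∞`; a universal-cover version of the argmax argument is the natural route).  Reading: the deep-target extension of r2 is CONSISTENT and would have to be proved with no margin
  (`10⁻¹²…10⁻¹⁵` relative at 30–36 sites), exactly like r2 (corner margins `∼ L⁻³…⁻⁴`, r2 Disproof §0).
* **F7 — floating past (deep START, mid-exploration), boundary target: PA HOLDS numerically**, although these
  carriers are outside r2's class (§6): 6×6 ∖ `{(2,2),(2,3)}`, tip `(2,1)`, `b ∈ {(0,0),(5,0),(5,5),(0,5),(5,2)}`: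
  margins `+2.7·10⁻¹³ … +3.8·10⁻⁷`, mixed `≤ −10⁻¹⁷`; L-shaped past `{(2,3),(2,2),(3,2)}`, tip `(4,2)`, `b` corner:
  `+1.6·10⁻¹⁰ … +2.6·10⁻⁷`; slit `{(2,1),(2,2),(2,3)}` with tip `(2,0)` ON the boundary row: equality cases
  (`Cov = 0` identically for some non-trivial pairs — single-vertex cut at the tip, cf. r2 Disproof tightness).
  So on this fragment the obstruction is NOT association but the RSW step: with a floating past the
  unforced-crossing probability is not bounded away from 1 (triage r1 S1/X1: two-corridor ring,
  `P(unforced crossing | past) = .905 → .996`, L = 2..12, kit j011295).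
* **F8 — TWO winding defects ⇒ PA false at every fugacity (weight-free, disjoint up-sets).**  (i) both endpoints
  deep: r2-disprover E6, PROVED (`leftRightFKG_false_without_boundaryAdjacency`, landing as
  `Theorems/LeftRightFKG/Negative/WithoutBoundaryAdjacency.lean`; supersedes this file's conditional
  `not_leftRightFKGFree_of_twoMax`); (ii) NEW: floating past + deep target — 6×6 ∖ `{(2,2),(2,3)}`, tip `(2,1)`,
  `b = (4,4)` (N = 49 653) and `b = (1,4)` (N = 29 811); L-past, tip `(4,2)`, `b = (1,1)` (N = 10 508): exact ratio
  `= 0` for a pair of elementary up-sets (`{θ_f ≥ c}` spiral round the hole vs `{θ_g ≥ c'}` spiral round `b`,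
  DISJOINT), mixed ratio up to `1.029`.
* **F9 — the pattern (conjecture from all data, 700+ carriers):** call a *winding defect* of a carrier a deep
  marked point (all eight king-neighbours in `S`) or a floating component of `ℤ² ∖ S`.  0 defects = admissible
  (F5: top/bottom, PA clean at `x_c` in every search to date); 1 defect: top/bottom still unique (9 000+ carriers) and PA holds
  at `x_c` with vanishing margins (F6, F7; r2 E4 annuli); ≥ 2 defects: two incomparable extreme spirals ⇒
  disjoint principal up-sets ⇒ PA false weight-free (F8).  For the crux: along the scheme's exploration a
  BOUNDARY-start/deep-target approximation stays at 1 defect (past attached to `∂`), a deep-start/boundary-target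
  one stays at 1 defect until the walk touches the boundary layer, a both-deep one starts at 2.  Hence repair
  (R2) "PA for ≤ 1-defect carriers" is numerically consistent — but it rescues only association, not the RSW
  step at a floating past (F7), and it is a strictly harder conjecture than r2 with zero margin. -/

/-! ## Targets (cycle 2): none assigned (`payload.targets = []`, no `PICKED.md`).  Stub-level kills already on
record from triage round 1 (for the lead, with pointers; NOT re-derived here):
* `Ideator2.RootedAnnulusBound` — FALSE AS TYPED (TRIAGE-r1-1 §W1, TRIAGE-r1-2: finger hung from the lintel
  vertex forces every lip-to-lip chord through a one-site gap `z₀` at distance `H − 1 ≥ C₀ r` from the lintel ⇒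
  `law = 1 > 1/2` for every `C₀`; exp/rooted_cex.py); repair: avoidability proviso (`JoinedIn (encl ∖ B̄(z₀, C₀r))`).
* `Ideator3.UniformTraversalTightness` (free-loop-rerouting) — false as typed (forced crossings; = sibling
  `not_constThreshold`); repair: per-shell forced allowance / quantile form (`Sketch.QuantileReduction`, provable).
* `Ideator1.UDTransfer` leans on `SAWBrownianDomination.UniformDomination`, refuted-misstated as typed (rings).
* Every surviving engine (lid-collapse-needle ≈ carve-reroot-drill ≈ carve-fill-sandwich; excursion-domination)
  is R1-ONLY (triage X1/P1 + §9 here): it proves at best `FKGToTraversalBoundBdry`. -/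

/-! ## §7 Near-misses (the only `sorry`s of this file): none at present. -/

end Summit.CriticalPhenomena.SAWScalingLimit.Cruxes.FKGToTraversalBound.Disproof
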